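import Mathlib
import HarnessLib
import Literature.Analysis.FluidPDE.HarmonicProbe
import Literature.Analysis.FluidPDE.FlatSwirlGauge
import Summits.NavierStokesRegularity.NavierStokesRegularity.Theorems.PoloidalWindowDoorLrcModEntireTHCertDictionary

/-!
# Route `PoloidalWindowDoor`, crux `PoloidalWindowRigidity` (stmt-19708) / item `LrcModEntire` (stmt-20428) —
# the normal-form local (TH)∩twisting statement MAY ASSUME `∂₁u₂(p₀) = 1` (parabolic scaling gauge)

Seat ns-poloidal-K2-p2 g8 (interim LEAD-of-record on 19708; file `--supports`).  Companion of `…TwistingTHLocalRotation`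
(`∂₀u₂(p₀) = 0 < ∂₁u₂(p₀)`): the local system {`∂₀u₁ = ∂₁u₀`, `div u = 0`, `∂₂u_b = μ(t,z)∂_bu₂`, E} is COVARIANT UNDER THE
PARABOLIC SCALING `u_c(s,y) = c·u(c²s, c y)`, `μ_c(s,z) = μ(c²s, cz)`, `A_c(s,z) = c³A(c²s, cz)` (`c ≠ 0`): first spatial derivatives
scale by `c²`, `∂ₜu₂`, `u·∇u₂`, `Δu₂`, `A`, `(∂ₜμ − ∂_z²μ)u₂`, `∂_zμ·u₂²`, `∂_zμ·∂₂u₂` all by `c³`, so E scales by `c³`; the pins at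
`p₀′ = (t₀/c², c⁻¹x₀)` are those at `p₀` up to positive powers of `c` (`twist ↦ c⁵·twist`, `∂_zμ ↦ c∂_zμ`, strain `↦ c²·strain`,
`u_c(p₀′) = c·u(p₀) = 0`), and `∂₁u₂ ↦ c²∂₁u₂`.  With `c = (∂₁u₂(p₀))^{-1/2}` the positive pin `∂₁u₂(p₀) > 0` becomes `= 1`.

* `localTHEmptyHypNFR_of_scaling` — **`hemptyHypNFR` ⇐ `hemptyHypNFRS`**: the rotated normal-form statement (binder `hR` of
  `…TwistingTHLocalRotation.localTHEmptyHypNF_of_rotation`) may replace `0 < ∂₁u₂(p₀)` by `∂₁u₂(p₀) = 1`.  Together: the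
  registered local statement may be attacked in the gauge `u(p₀) = 0`, `∇ₕu₂(p₀) = (0,1)` — complex slice letter `w₁₀ = −i/2`,
  real letters `Rw_1_0 = 0`, `Iw_1_0 = −1/2` (KERNEL-CERT-FORMAT-g8 §3; DIRECTOR-NS #103 (4)).

WHAT THIS IS NOT: not a proof of the stub and not a claim about Navier–Stokes regularity — a free normalisation of the registered
local statement (bears_on LADDER-NS N0 via crux 19708 / item 20428).
-/

noncomputable section

-- the summit and its single sub-problem share the name (CONVENTIONS §1), as in every Theorems file
set_option linter.dupNamespace false

namespace Summit.NavierStokesRegularity.NavierStokesRegularity.Theorems.PoloidalWindowDoorLrcModEntireTwistingTHLocalScaling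

open Set Function Filter Topology Metric
open scoped RealInnerProductSpace InnerProductSpace Laplacian
open Literature.Analysis Literature.Analysis.FluidPDE
open Summit.NavierStokesRegularity.NavierStokesRegularity.Theorems.PoloidalWindowDoorLrcModEntireTHCertLetters
open Summit.NavierStokesRegularity.NavierStokesRegularity.Theorems.PoloidalWindowDoorLrcModEntireTHCertDictionary

/-! ### The relocation: `hemptyHypNFR` ⇐ `hemptyHypNFRS` -/

/-- **The rotated normal-form local (TH)∩twisting statement may assume `∂₁u₂(p₀) = 1`.**  `hemptyHypNFRS` is `hemptyHypNFR`
(binder `hR` of `…TwistingTHLocalRotation.localTHEmptyHypNF_of_rotation`) with its last hypothesis `0 < ∂₁u₂(p₀)` replaced by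
`∂₁u₂(p₀) = 1`; then `hemptyHypNFRS → hemptyHypNFR` (parabolic scaling by `c = (∂₁u₂(p₀))^{-1/2}`). [folklore] -/
theorem localTHEmptyHypNFR_of_scaling
    (hS : ∀ (u : ℝ → EuclideanSpace ℝ (Fin 3) → EuclideanSpace ℝ (Fin 3)) (μ A : ℝ → ℝ → ℝ)
      (U : Set (ℝ × EuclideanSpace ℝ (Fin 3))) (p₀ : ℝ × EuclideanSpace ℝ (Fin 3)),
      IsOpen U → p₀ ∈ U →
      AnalyticOnNhd ℝ (Function.uncurry u) U →
      (∀ p ∈ U, AnalyticAt ℝ (Function.uncurry μ) (p.1, p.2 2)) →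
      (∀ p ∈ U, AnalyticAt ℝ (Function.uncurry A) (p.1, p.2 2)) →
      (∀ p ∈ U, fderiv ℝ (u p.1) p.2 (EuclideanSpace.single 0 1) 1 = fderiv ℝ (u p.1) p.2 (EuclideanSpace.single 1 1) 0) →
      (∀ p ∈ U, fderiv ℝ (u p.1) p.2 (EuclideanSpace.single 0 1) 0 + fderiv ℝ (u p.1) p.2 (EuclideanSpace.single 1 1) 1 +
        fderiv ℝ (u p.1) p.2 (EuclideanSpace.single 2 1) 2 = 0) →
      (∀ p ∈ U, ∀ b : Fin 3, b ≠ 2 →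
        fderiv ℝ (u p.1) p.2 (EuclideanSpace.single 2 1) b =
          μ p.1 (p.2 2) * fderiv ℝ (u p.1) p.2 (EuclideanSpace.single b 1) 2) →
      (∀ p ∈ U,
        (1 - μ p.1 (p.2 2)) *
            (deriv (fun s => u s p.2 2) p.1 + fderiv ℝ (fun y => u p.1 y 2) p.2 (u p.1 p.2)
              - Δ (fun y => u p.1 y 2) p.2) =
          A p.1 (p.2 2) + (deriv (fun s => μ s (p.2 2)) p.1 - deriv (deriv (μ p.1)) (p.2 2)) * u p.1 p.2 2
            + deriv (μ p.1) (p.2 2) / 2 * u p.1 p.2 2 ^ 2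
            - 2 * deriv (μ p.1) (p.2 2) * fderiv ℝ (u p.1) p.2 (EuclideanSpace.single 2 1) 2) →
      fderiv ℝ (fun y => fderiv ℝ (u p₀.1) y (EuclideanSpace.single 2 1) 2) p₀.2 (EuclideanSpace.single 0 1) *
            fderiv ℝ (u p₀.1) p₀.2 (EuclideanSpace.single 1 1) 2 -
          fderiv ℝ (fun y => fderiv ℝ (u p₀.1) y (EuclideanSpace.single 2 1) 2) p₀.2 (EuclideanSpace.single 1 1) *
            fderiv ℝ (u p₀.1) p₀.2 (EuclideanSpace.single 0 1) 2 ≠ 0 →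
      μ p₀.1 (p₀.2 2) ≠ 0 → μ p₀.1 (p₀.2 2) ≠ 1 → deriv (μ p₀.1) (p₀.2 2) ≠ 0 →
      μ p₀.1 (p₀.2 2) < 0 →
      (fderiv ℝ (u p₀.1) p₀.2 (EuclideanSpace.single 0 1) 0 ≠ fderiv ℝ (u p₀.1) p₀.2 (EuclideanSpace.single 1 1) 1 ∨
        fderiv ℝ (u p₀.1) p₀.2 (EuclideanSpace.single 1 1) 0 ≠ 0) →
      u p₀.1 p₀.2 = 0 →
      fderiv ℝ (u p₀.1) p₀.2 (EuclideanSpace.single 0 1) 2 = 0 →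
      fderiv ℝ (u p₀.1) p₀.2 (EuclideanSpace.single 1 1) 2 = 1 → False) :
    ∀ (u : ℝ → EuclideanSpace ℝ (Fin 3) → EuclideanSpace ℝ (Fin 3)) (μ A : ℝ → ℝ → ℝ)
      (U : Set (ℝ × EuclideanSpace ℝ (Fin 3))) (p₀ : ℝ × EuclideanSpace ℝ (Fin 3)),
      IsOpen U → p₀ ∈ U →
      AnalyticOnNhd ℝ (Function.uncurry u) U →
      (∀ p ∈ U, AnalyticAt ℝ (Function.uncurry μ) (p.1, p.2 2)) →
      (∀ p ∈ U, AnalyticAt ℝ (Function.uncurry A) (p.1, p.2 2)) →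
      (∀ p ∈ U, fderiv ℝ (u p.1) p.2 (EuclideanSpace.single 0 1) 1 = fderiv ℝ (u p.1) p.2 (EuclideanSpace.single 1 1) 0) →
      (∀ p ∈ U, fderiv ℝ (u p.1) p.2 (EuclideanSpace.single 0 1) 0 + fderiv ℝ (u p.1) p.2 (EuclideanSpace.single 1 1) 1 +
        fderiv ℝ (u p.1) p.2 (EuclideanSpace.single 2 1) 2 = 0) →
      (∀ p ∈ U, ∀ b : Fin 3, b ≠ 2 →
        fderiv ℝ (u p.1) p.2 (EuclideanSpace.single 2 1) b =
          μ p.1 (p.2 2) * fderiv ℝ (u p.1) p.2 (EuclideanSpace.single b 1) 2) →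
      (∀ p ∈ U,
        (1 - μ p.1 (p.2 2)) *
            (deriv (fun s => u s p.2 2) p.1 + fderiv ℝ (fun y => u p.1 y 2) p.2 (u p.1 p.2)
              - Δ (fun y => u p.1 y 2) p.2) =
          A p.1 (p.2 2) + (deriv (fun s => μ s (p.2 2)) p.1 - deriv (deriv (μ p.1)) (p.2 2)) * u p.1 p.2 2
            + deriv (μ p.1) (p.2 2) / 2 * u p.1 p.2 2 ^ 2
            - 2 * deriv (μ p.1) (p.2 2) * fderiv ℝ (u p.1) p.2 (EuclideanSpace.single 2 1) 2) →
      fderiv ℝ (fun y => fderiv ℝ (u p₀.1) y (EuclideanSpace.single 2 1) 2) p₀.2 (EuclideanSpace.single 0 1) *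
            fderiv ℝ (u p₀.1) p₀.2 (EuclideanSpace.single 1 1) 2 -
          fderiv ℝ (fun y => fderiv ℝ (u p₀.1) y (EuclideanSpace.single 2 1) 2) p₀.2 (EuclideanSpace.single 1 1) *
            fderiv ℝ (u p₀.1) p₀.2 (EuclideanSpace.single 0 1) 2 ≠ 0 →
      μ p₀.1 (p₀.2 2) ≠ 0 → μ p₀.1 (p₀.2 2) ≠ 1 → deriv (μ p₀.1) (p₀.2 2) ≠ 0 →
      μ p₀.1 (p₀.2 2) < 0 →
      (fderiv ℝ (u p₀.1) p₀.2 (EuclideanSpace.single 0 1) 0 ≠ fderiv ℝ (u p₀.1) p₀.2 (EuclideanSpace.single 1 1) 1 ∨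
        fderiv ℝ (u p₀.1) p₀.2 (EuclideanSpace.single 1 1) 0 ≠ 0) →
      u p₀.1 p₀.2 = 0 →
      fderiv ℝ (u p₀.1) p₀.2 (EuclideanSpace.single 0 1) 2 = 0 →
      0 < fderiv ℝ (u p₀.1) p₀.2 (EuclideanSpace.single 1 1) 2 → False := by
  intro u μ A U p₀ hU hp₀ hu hμ hA hpol hdiv hsh hE htw hm0 hm1 hmz hneg hNU hrest hW0 hW1
  obtain ⟨t₀, x₀⟩ := p₀
  dsimp only at hp₀ htw hm0 hm1 hmz hneg hNU hrest hW0 hW1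
  -- the scale
  set c : ℝ := (Real.sqrt (fderiv ℝ (u t₀) x₀ (EuclideanSpace.single 1 1) 2))⁻¹ with hc
  have hcpos : 0 < c := inv_pos.mpr (Real.sqrt_pos.mpr hW1)
  have hc0 : c ≠ 0 := hcpos.ne'
  have hc2 : c * c * fderiv ℝ (u t₀) x₀ (EuclideanSpace.single 1 1) 2 = 1 := by
    rw [hc, ← sq, inv_pow, Real.sq_sqrt hW1.le]; field_simp
  -- the scaled datum
  set u' : ℝ → EuclideanSpace ℝ (Fin 3) → EuclideanSpace ℝ (Fin 3) := fun s y => c • u (c ^ 2 * s) (c • y) with hu'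
  set μ' : ℝ → ℝ → ℝ := fun s z => μ (c ^ 2 * s) (c * z) with hμ'
  set A' : ℝ → ℝ → ℝ := fun s z => c ^ 3 * A (c ^ 2 * s) (c * z) with hA'
  set U' : Set (ℝ × EuclideanSpace ℝ (Fin 3)) :=
    {p | ((c ^ 2 * p.1, c • p.2) : ℝ × EuclideanSpace ℝ (Fin 3)) ∈ U} with hU'
  have hτc : Continuous (fun p : ℝ × EuclideanSpace ℝ (Fin 3) =>
      ((c ^ 2 * p.1, c • p.2) : ℝ × EuclideanSpace ℝ (Fin 3))) := by fun_prop
  have hτa : ∀ p : ℝ × EuclideanSpace ℝ (Fin 3), AnalyticAt ℝ (fun p : ℝ × EuclideanSpace ℝ (Fin 3) =>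
      ((c ^ 2 * p.1, c • p.2) : ℝ × EuclideanSpace ℝ (Fin 3))) p := fun p =>
    (analyticAt_const.mul analyticAt_fst).prod (analyticAt_snd.const_smul (c := c))
  have hσa : ∀ q : ℝ × ℝ, AnalyticAt ℝ (fun q : ℝ × ℝ => ((c ^ 2 * q.1, c * q.2) : ℝ × ℝ)) q := fun q =>
    (analyticAt_const.mul analyticAt_fst).prod (analyticAt_const.mul analyticAt_snd)
  have hU'o : IsOpen U' := hU.preimage hτc
  have hsm2 : ∀ y : EuclideanSpace ℝ (Fin 3), (c • y) 2 = c * y 2 := fun y => by simp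
  have hT : c ^ 2 * (t₀ / c ^ 2) = t₀ := by field_simp
  have hX : c • c⁻¹ • x₀ = x₀ := by rw [smul_smul, mul_inv_cancel₀ hc0, one_smul]
  have hp₀' : ((t₀ / c ^ 2, c⁻¹ • x₀) : ℝ × EuclideanSpace ℝ (Fin 3)) ∈ U' := by
    show ((c ^ 2 * (t₀ / c ^ 2), c • c⁻¹ • x₀) : ℝ × EuclideanSpace ℝ (Fin 3)) ∈ U
    rw [hT, hX]; exact hp₀
  -- analyticity of the scaled datum
  have hu'a : AnalyticOnNhd ℝ (uncurry u') U' := by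
    intro p hp
    have h := (AnalyticAt.comp (g := uncurry u)
      (f := fun p : ℝ × EuclideanSpace ℝ (Fin 3) => ((c ^ 2 * p.1, c • p.2) : ℝ × EuclideanSpace ℝ (Fin 3)))
      (hu _ hp) (hτa p)).const_smul (c := c)
    refine h.congr (Eventually.of_forall fun q => ?_)
    obtain ⟨s, z⟩ := q; rfl
  have hμ'a : ∀ p ∈ U', AnalyticAt ℝ (uncurry μ') (p.1, p.2 2) := by
    intro p hp
    have h1 : AnalyticAt ℝ (uncurry μ) (c ^ 2 * p.1, c * p.2 2) := by rw [← hsm2]; exact hμ _ hp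
    have h := AnalyticAt.comp (g := uncurry μ) (f := fun q : ℝ × ℝ => ((c ^ 2 * q.1, c * q.2) : ℝ × ℝ))
      (x := (p.1, p.2 2)) h1 (hσa _)
    refine h.congr (Eventually.of_forall fun q => ?_)
    obtain ⟨s, ζ⟩ := q; rfl
  have hA'a : ∀ p ∈ U', AnalyticAt ℝ (uncurry A') (p.1, p.2 2) := by
    intro p hp
    have h1 : AnalyticAt ℝ (uncurry A) (c ^ 2 * p.1, c * p.2 2) := by rw [← hsm2]; exact hA _ hp
    have h := (AnalyticAt.comp (g := uncurry A) (f := fun q : ℝ × ℝ => ((c ^ 2 * q.1, c * q.2) : ℝ × ℝ))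
      (x := (p.1, p.2 2)) h1 (hσa _)).const_smul (c := c ^ 3)
    refine h.congr (Eventually.of_forall fun q => ?_)
    obtain ⟨s, ζ⟩ := q; simp [hA', smul_eq_mul]
  -- first derivatives of the scaled field: `c²` times the derivatives at the scaled point
  have hD : ∀ (s : ℝ) (y e : EuclideanSpace ℝ (Fin 3)) (i : Fin 3),
      fderiv ℝ (u' s) y e i = c * c * fderiv ℝ (u (c ^ 2 * s)) (c • y) e i := fun s y e i => by
    rw [hu']; dsimp only
    rw [fderiv_const_smul_comp_smul_apply (u (c ^ 2 * s)) c c y, FunLike.coe_smul, Pi.smul_apply, PiLp.smul_apply,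
      smul_eq_mul]
  have hslope : ∀ (s : ℝ) (y : EuclideanSpace ℝ (Fin 3)), μ' s (y 2) = μ (c ^ 2 * s) ((c • y) 2) := fun s y => by
    rw [hμ', hsm2]
  -- the kinematic identities transfer
  have hpol' : ∀ p ∈ U', fderiv ℝ (u' p.1) p.2 (EuclideanSpace.single 0 1) 1 =
      fderiv ℝ (u' p.1) p.2 (EuclideanSpace.single 1 1) 0 := fun p hp => by
    rw [hD, hD, hpol _ hp]
  have hdiv' : ∀ p ∈ U', fderiv ℝ (u' p.1) p.2 (EuclideanSpace.single 0 1) 0 +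
      fderiv ℝ (u' p.1) p.2 (EuclideanSpace.single 1 1) 1 + fderiv ℝ (u' p.1) p.2 (EuclideanSpace.single 2 1) 2 = 0 :=
    fun p hp => by
    have h := hdiv _ hp
    dsimp only at h
    rw [hD, hD, hD]
    linear_combination c * c * h
  have hsh' : ∀ p ∈ U', ∀ b : Fin 3, b ≠ 2 → fderiv ℝ (u' p.1) p.2 (EuclideanSpace.single 2 1) b =
      μ' p.1 (p.2 2) * fderiv ℝ (u' p.1) p.2 (EuclideanSpace.single b 1) 2 := fun p hp b hb => by
    have h := hsh _ hp b hb
    dsimp only at h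
    rw [hD, hD, hslope, h]; ring
  -- the scalar law transfers: E scales by `c³`
  have hE' : ∀ p ∈ U',
      (1 - μ' p.1 (p.2 2)) *
          (deriv (fun s => u' s p.2 2) p.1 + fderiv ℝ (fun y => u' p.1 y 2) p.2 (u' p.1 p.2)
            - Δ (fun y => u' p.1 y 2) p.2) =
        A' p.1 (p.2 2) + (deriv (fun s => μ' s (p.2 2)) p.1 - deriv (deriv (μ' p.1)) (p.2 2)) * u' p.1 p.2 2
          + deriv (μ' p.1) (p.2 2) / 2 * u' p.1 p.2 2 ^ 2
          - 2 * deriv (μ' p.1) (p.2 2) * fderiv ℝ (u' p.1) p.2 (EuclideanSpace.single 2 1) 2 := by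
    intro p hp
    obtain ⟨s, y⟩ := p
    have hq : ((c ^ 2 * s, c • y) : ℝ × EuclideanSpace ℝ (Fin 3)) ∈ U := hp
    have h := hE _ hq
    dsimp only at h ⊢
    rw [hsm2] at h
    -- time derivative
    have e1 : (fun σ => u' σ y 2) = fun σ => c * (fun t => u t (c • y) 2) (c ^ 2 * σ) := by
      funext σ; simp [hu']
    have e1' : deriv (fun σ => u' σ y 2) s = c * (c ^ 2 * deriv (fun t => u t (c • y) 2) (c ^ 2 * s)) := by
      rw [e1, deriv_const_mul_field, deriv_comp_mul_left (c ^ 2) (fun t => u t (c • y) 2) s, smul_eq_mul]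
    -- the slice `y ↦ u′₂(s,y) = c • u₂(c²s, c y)`
    have e2 : (fun z => u' s z 2) = fun z => c • (fun x => u (c ^ 2 * s) x 2) (c • z) := by
      funext z; simp [hu']
    have e3 : u' s y 2 = c * u (c ^ 2 * s) (c • y) 2 := by simp [hu']
    have e4 : fderiv ℝ (fun z => c • (fun x => u (c ^ 2 * s) x 2) (c • z)) y (u' s y) =
        c * c * c * fderiv ℝ (fun x => u (c ^ 2 * s) x 2) (c • y) (u (c ^ 2 * s) (c • y)) := by
      rw [fderiv_const_smul_comp_smul_apply (fun x => u (c ^ 2 * s) x 2) c c y, FunLike.coe_smul, Pi.smul_apply, hu']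
      dsimp only
      rw [map_smul, smul_eq_mul, smul_eq_mul]; ring
    have e5 : Δ (fun z => c • (fun x => u (c ^ 2 * s) x 2) (c • z)) y =
        c * c ^ 2 * Δ (fun x => u (c ^ 2 * s) x 2) (c • y) := by
      rw [laplacian_const_smul_comp_smul (fun x => u (c ^ 2 * s) x 2) c hc0 y, smul_eq_mul]
    -- slope derivatives
    have e6 : deriv (μ' s) (y 2) = c * deriv (μ (c ^ 2 * s)) (c * y 2) := by
      rw [hμ']; dsimp only; rw [deriv_comp_mul_left c (μ (c ^ 2 * s)) (y 2), smul_eq_mul]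
    have e7 : deriv (deriv (μ' s)) (y 2) = c * (c * deriv (deriv (μ (c ^ 2 * s))) (c * y 2)) := by
      have hf : deriv (μ' s) = fun z => c * deriv (μ (c ^ 2 * s)) (c * z) := by
        funext z; rw [hμ']; dsimp only; rw [deriv_comp_mul_left c (μ (c ^ 2 * s)) z, smul_eq_mul]
      rw [hf, deriv_const_mul_field, deriv_comp_mul_left c (deriv (μ (c ^ 2 * s))) (y 2), smul_eq_mul]
    have e8 : deriv (fun σ => μ' σ (y 2)) s = c ^ 2 * deriv (fun t => μ t (c * y 2)) (c ^ 2 * s) := by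
      have hf : (fun σ => μ' σ (y 2)) = fun σ => (fun t => μ t (c * y 2)) (c ^ 2 * σ) := by funext σ; simp [hμ']
      rw [hf, deriv_comp_mul_left (c ^ 2) (fun t => μ t (c * y 2)) s, smul_eq_mul]
    rw [e1', e2, e3, e4, e5, e6, e7, e8, hslope, hsm2, hD, hA']
    dsimp only
    linear_combination c ^ 3 * h
  -- the pins at `p₀′ = (t₀/c², c⁻¹x₀)`
  have hD₀ : ∀ (e : EuclideanSpace ℝ (Fin 3)) (i : Fin 3),
      fderiv ℝ (u' (t₀ / c ^ 2)) (c⁻¹ • x₀) e i = c * c * fderiv ℝ (u t₀) x₀ e i := fun e i => by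
    rw [hD, hT, hX]
  have hG₀ : ∀ e : EuclideanSpace ℝ (Fin 3),
      fderiv ℝ (fun y => fderiv ℝ (u' (t₀ / c ^ 2)) y (EuclideanSpace.single 2 1) 2) (c⁻¹ • x₀) e =
        c * c * c * fderiv ℝ (fun y => fderiv ℝ (u t₀) y (EuclideanSpace.single 2 1) 2) x₀ e := fun e => by
    have hfun : (fun y => fderiv ℝ (u' (t₀ / c ^ 2)) y (EuclideanSpace.single 2 1) 2) =
        fun y => (c * c) • (fun x => fderiv ℝ (u t₀) x (EuclideanSpace.single 2 1) 2) (c • y) := by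
      funext y; rw [hD, hT, smul_eq_mul]
    rw [hfun, fderiv_const_smul_comp_smul_apply (fun x => fderiv ℝ (u t₀) x (EuclideanSpace.single 2 1) 2) (c * c) c,
      FunLike.coe_smul, Pi.smul_apply, hX, smul_eq_mul]
  have hsl₀ : μ' (t₀ / c ^ 2) ((c⁻¹ • x₀) 2) = μ t₀ (x₀ 2) := by
    rw [hμ']; dsimp only; rw [hT, PiLp.smul_apply, smul_eq_mul, ← mul_assoc, mul_inv_cancel₀ hc0, one_mul]
  have hslz₀ : deriv (μ' (t₀ / c ^ 2)) ((c⁻¹ • x₀) 2) = c * deriv (μ t₀) (x₀ 2) := by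
    rw [hμ']; dsimp only
    rw [deriv_comp_mul_left c (μ (c ^ 2 * (t₀ / c ^ 2))) ((c⁻¹ • x₀) 2), hT, PiLp.smul_apply, smul_eq_mul, smul_eq_mul,
      ← mul_assoc, mul_inv_cancel₀ hc0, one_mul]
  refine hS u' μ' A' U' (t₀ / c ^ 2, c⁻¹ • x₀) hU'o hp₀' hu'a hμ'a hA'a hpol' hdiv' hsh' hE' ?_ ?_ ?_ ?_ ?_ ?_ ?_ ?_ ?_
  · -- twist scales by `c⁵`
    dsimp only
    rw [hG₀, hG₀, hD₀, hD₀]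
    intro h
    apply htw
    have h5 : (c * c * c) * (c * c) ≠ 0 := by positivity
    refine (mul_eq_zero.mp ?_).resolve_left h5
    linear_combination h
  · dsimp only; rw [hsl₀]; exact hm0
  · dsimp only; rw [hsl₀]; exact hm1
  · dsimp only; rw [hslz₀]; exact mul_ne_zero hc0 hmz
  · dsimp only; rw [hsl₀]; exact hneg
  · -- the non-umbilic pin scales by `c²`
    dsimp only
    rw [hD₀, hD₀, hD₀]
    have hcc : c * c ≠ 0 := mul_ne_zero hc0 hc0
    rcases hNU with hne | hne
    · left; intro h; exact hne (mul_left_cancel₀ hcc h)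
    · right; intro h; exact hne ((mul_eq_zero.mp h).resolve_left hcc)
  · -- rest point
    dsimp only; rw [hu']; dsimp only; rw [hT, hX, hrest, smul_zero]
  · dsimp only; rw [hD₀, hW0, mul_zero]
  · dsimp only; rw [hD₀]; exact hc2

end Summit.NavierStokesRegularity.NavierStokesRegularity.Theorems.PoloidalWindowDoorLrcModEntireTwistingTHLocalScaling

end
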